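import Literature.MathematicalPhysics.QuantumFieldTheory.Balaban1983to89.B3Ineq213Proof
import Literature.MathematicalPhysics.QuantumFieldTheory.Balaban1983to89.B3Ineq210ZeroBox

/-!
# B3 (2.13) p. 426 — the line hypothesis (2.10) of the localized lattice amplitudes DISCHARGED for the zero-field box
# line class: graphs of undifferentiated scalar propagators `G_k(□, 0)` expanded by (2.6)

T. Bałaban, *(Higgs)₂,₃ quantum fields in a finite volume. III. Renormalization*, Commun. Math. Phys. **88** (1983)
411–445 [Balaban1983Higgs3], Sect. 2, pp. 424–427 [PDF 14–17] (journal page = PDF page + 410; held text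
`paper:balaban1983-higgs-2-3-quantum-fields-finite-volume`).

statement-level skeleton of published theorems with citation tags; proofs where landed; nothing here is a claim about
the Yang–Mills mass gap

Cell `lit-balaban` (HOME `run/shared/lean/pub/lit-balaban/`), Phase-2 proof seat `lit-balaban-p03` gen 5, rows
**B3.Eq2.13-2.14** and **B3.Eq2.10** (owner r15).  THEOREMS plus three definitions with bodies (`lineK`, `boxCounts`,
`boxAmp`); imports p19's `B3Ineq213Proof` (the class `B3Ineq213.Amp` of localized lattice graph amplitudes with its
estimate `Amp.ineq213` = (2.13) and `Amp.bound133` = (1.33) at a fixed ordering) and the gen-4 zero-field box instance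
of (2.10) `B3Ineq210ZeroBox` (`piece` = the (2.6) pieces `G^η_{(j)}` of `G_k(□,0)`, `ineq210_zeroBox`).  No new
`def … : Prop`; no existing declaration is modified.

## What is printed

p. 426 [PDF 16]: *"In the next step we make a first estimate of the expression. We estimate it taking absolute values
of all factors. … For the propagators G^η_{(j)} we apply the inequality
|G^η_{(j)}(Ω, B̃; x, x′)| ≦ O(1)(L^jη)^{−d+2}e^{−δ₁(L^jη)^{−1}|x−x′|},   (2.10)
… They all are obtained by rescaling from the η-lattice to the L^{−j}-lattice and application of Propositions I.2.1
and I.2.3."* and then (2.13).  p. 424 [PDF 14], (2.6)–(2.7): the propagators of the graph are expanded,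
`G_k(Ω,B̃) = Σ_{j=0}^{k−1} G^η_{(j)}(Ω,B̃)`, `E(G,…) = Σ_{j} E(G(j),…)`.

## What p19's class takes as a hypothesis, and what this file discharges

`B3Ineq213.Amp M` (p19, `B3Ineq213Amplitude`) is the localized lattice amplitude `E_j = Σ_{x_v ∈ □(v)} Π_v η^d u_v(x_v)
Π_l K_l(j_l; x_{v_l}, x_{v′_l})` over p19/gen-2's generalized graph `M : B3Ineq215.Model V m`, with the line bounds
(2.10)–(2.12) as the HYPOTHESIS `Amp.K_le : |K_l(t; x, x′)| ≤ C_l (L^tη)^{a_l} e^{−2δ₀(L^tη)^{−1}·η|x−x′|_∞}` (row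
B3.Eq2.13-2.14 records: *"Not modelled: the derivation of the hypotheses (i)–(ii) from … Propositions I.2.1/I.2.3"*).
HERE, for the ZERO-FIELD BOX LINE CLASS — every line of the graph an undifferentiated scalar propagator with no averaged
vector leg (`diffOn = 0`, `vecLegAvg = 0`, so `a_l = lineDim l = −(d−2)`, `boxCounts_lineDim`), the region a box
`Ω = □ = Π_μ[0, M_μ)` of unit cubes at scale `k` (`η = L^{−k}`), external field `A = B̃ = 0` — the line kernels are
DEFINED as the (2.6) pieces of the box propagator, `K_l(t; x, x′) = η^{−(d+1)}·G^η_{(t)}(□,0; x, x′)` (`lineK`: gen-4's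
`B3Ineq210ZeroBox.piece ℓ k M t a m²` read in the `η^d`-weighted kernel units of p19's `E`, zero outside `□`), and the
hypothesis `K_le` is PROVED (`lineK_le`, from `B3Ineq210ZeroBox.ineq210_zeroBox`) with ONE pair of constants
`(δ₁, C)` depending on `d`, `L` and the coefficient window `[a₋, a₊] × [0, m²₊]` only — uniformly in the scale
`k ≥ 1`, the box and the graph.  `boxAmp` is the resulting amplitude (vertex side — the functions `u_v`, orders
`d_v, d_s`, norms `N^Φ_v, N^A_v`, couplings and the vertex bound `u_le` — supplied by the user as `VertexData`, exactly
p19's hypothesis (i); connectivity = Proposition 2.1's *"Let G be a connected graph"*), and p19's theorems apply to it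
with NO line hypothesis: `ineq213_boxAmp` ((2.13) at every scale assignment of `J(l̃)`), `ineq213_sum_boxAmp`,
`bound133_boxAmp` ((1.33) for the fixed ordering, given Proposition 2.2's positivity of the subgraph degrees).
`sum_lineK` records that the lines ARE the propagator: `Σ_{t<k} K_l(t; x, x′) = η^{−(d+1)}G_k(□,0; x, x′)` ((2.6),
`B3Ineq210ZeroBox.sum_piece`).

## Declared divergences / scope

(i) `A = B̃ = 0` and `Ω = □` only (the print: general Ω ⊂ T_η, unions of big blocks, small fields — rows B3.Eq2.10–2.12
heads stay typed); (ii) only undifferentiated scalar lines without averaged legs (the differentiated / averaged-leg /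
Hölder line factors (2.10)′/(2.11)/(2.12) have zero-field box instances in `B3Ineq210ZeroBox`/`B3Ineq211ZeroBox`/
`B3Ineq212ZeroBox` but are not wired into `Amp` here); (iii) dimension written `d + 1 ≥ 1` (B4-lineage convention),
`L = ℓ + 1 ≥ 2`; (iv) the vertex hypothesis (i) of p19 stays a hypothesis (`VertexData.u_le`); (v) positions are p19's
`Fin (d+1) → ℕ` (η-units), identified with the fine sites `boxDom (L^k·M)` of the gen-4 box by the cast `toZ`.
-/

namespace Literature.MathematicalPhysics.QuantumFieldTheory.Balaban1983to89.B3Ineq213ZeroBoxLines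

open Finset
open Literature.MathematicalPhysics.QuantumFieldTheory.Balaban1983to89.B3Ineq215
open Literature.MathematicalPhysics.QuantumFieldTheory.Balaban1983to89.B3Ineq213
open Literature.MathematicalPhysics.QuantumFieldTheory.Balaban1983to89.B3Ineq210ZeroBox
open Literature.MathematicalPhysics.QuantumFieldTheory.Balaban1983to89.B4Reflection242 (boxDom mem_boxDom)
open Literature.MathematicalPhysics.QuantumFieldTheory.Balaban1983to89.B4ContourShift (supNorm exists_supNorm_eq
  abs_le_supNorm supNorm_nonneg)
open Literature.MathematicalPhysics.QuantumFieldTheory.Balaban1983to89.B4Thm110ZeroBox (Nf)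

noncomputable section

variable {d : ℕ}

/-! ## §1 Positions: p19's `Fin (d+1) → ℕ` versus the fine sites `boxDom N ⊂ ℤ^{d+1}` -/

/-- the integer coordinates of a position. [folklore] -/
def toZ (x : Fin (d + 1) → ℕ) : Fin (d + 1) → ℤ := fun i => (x i : ℤ)

/-- «the position lies in the box `□ = Π_μ[0, N_μ)`» (positions in η-units). [cite: Balaban1983Higgs3, (2.6) p.424] -/
def InBox (N : Fin (d + 1) → ℕ) (x : Fin (d + 1) → ℕ) : Prop := ∀ i, x i < N i

/-- membership in the box is decidable. [folklore] -/
instance (N : Fin (d + 1) → ℕ) (x : Fin (d + 1) → ℕ) : Decidable (InBox N x) := by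
  unfold InBox; infer_instance

/-- a position in the box is a fine site of `boxDom N`. [cite: Balaban1983Higgs3, (2.6) p.424] -/
theorem toZ_mem {N : Fin (d + 1) → ℕ} {x : Fin (d + 1) → ℕ} (h : InBox N x) : toZ x ∈ boxDom N :=
  mem_boxDom.2 fun i => ⟨Int.natCast_nonneg _, by simp only [toZ]; exact_mod_cast h i⟩

/-- the fine site of a position in the box. [folklore] -/
def site {N : Fin (d + 1) → ℕ} (x : Fin (d + 1) → ℕ) (h : InBox N x) : ↥(boxDom N) := ⟨toZ x, toZ_mem h⟩

/-- `Nat.dist` is the absolute difference. [folklore] -/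
private theorem cast_natDist (a b : ℕ) : ((Nat.dist a b : ℕ) : ℝ) = (((|(a : ℤ) - (b : ℤ)| : ℤ)) : ℝ) := by
  rcases le_total a b with h | h
  · rw [Nat.dist_eq_sub_of_le h, abs_sub_comm, abs_of_nonneg (by omega)]
    push_cast [h]
    ring
  · rw [Nat.dist_eq_sub_of_le_right h, abs_of_nonneg (by omega)]
    push_cast [h]
    ring

/-- p19's sup-distance of positions = the B4-lineage sup norm of the difference of their fine sites.
[cite: Balaban1983Higgs3, (2.10) p.426] -/
theorem supNorm_toZ_sub (x y : Fin (d + 1) → ℕ) : supNorm (toZ x - toZ y) = (supDist x y : ℝ) := by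
  apply le_antisymm
  · refine Finset.sup'_le _ _ fun i _ => ?_
    rw [Pi.sub_apply, toZ, toZ, ← cast_natDist]
    exact_mod_cast dist_le_supDist x y i
  · obtain ⟨i, _, hi⟩ := Finset.exists_mem_eq_sup (univ : Finset (Fin (d + 1))) univ_nonempty
      (fun μ => Nat.dist (x μ) (y μ))
    have h1 : (supDist x y : ℝ) = ((Nat.dist (x i) (y i) : ℕ) : ℝ) := by
      unfold supDist; exact_mod_cast hi
    rw [h1, cast_natDist]
    exact abs_le_supNorm (toZ x - toZ y) i

/-! ## §2 The line kernels: the (2.6) pieces of `G_k(□,0)` in `η^d`-weighted kernel units -/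

/-- the length scale `L^tη = L^t·L^{−k}` of the `t`-th piece (`= B3Ineq215.Model.sc` of a model with block size `L = ℓ+1`,
`= ScaledKernels.scale` of the gen-4 box carrier). [cite: Balaban1983Higgs3, (2.10) p.426] -/
def bscale (ℓ k t : ℕ) : ℝ := ((ℓ : ℝ) + 1) ^ t * ((((ℓ + 1) ^ k : ℕ) : ℝ))⁻¹

/-- `L^tη > 0`. [cite: Balaban1983Higgs3, (2.10) p.426] -/
theorem bscale_pos (ℓ k t : ℕ) : 0 < bscale ℓ k t := by
  unfold bscale; positivity

/-- **The line kernel of an undifferentiated scalar line at scale index `t`**: `K(t; x, x′) = η^{−(d+1)}·G^η_{(t)}(□,0; x, x′)`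
for positions `x, x′ ∈ □` (gen-4's `piece ℓ k M t a m²`, the `t`-th (2.6) piece of the zero-field box propagator in the
counting normalisation, multiplied by `η^{−(d+1)} = L^{k(d+1)}` to pass to the `η^d`-weighted kernel units of p19's
amplitude `E`), and `0` if a position is outside the box. [cite: Balaban1983Higgs3, (2.6) p.424, (2.10) p.426] -/
def lineK (ℓ k : ℕ) (M : Fin (d + 1) → ℕ) (a m2 : ℝ) (t : ℕ) (x x' : Fin (d + 1) → ℕ) : ℝ :=
  if h : InBox (Nf ℓ k M) x ∧ InBox (Nf ℓ k M) x' then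
    ((((ℓ + 1) ^ k : ℕ) : ℝ)) ^ (d + 1) * piece ℓ k M t a m2 (site x h.1) (site x' h.2)
  else 0

/-- the kernel inside the box. [cite: Balaban1983Higgs3, (2.6) p.424] -/
theorem lineK_of_inBox {ℓ k : ℕ} {M : Fin (d + 1) → ℕ} {a m2 : ℝ} (t : ℕ) {x x' : Fin (d + 1) → ℕ}
    (hx : InBox (Nf ℓ k M) x) (hx' : InBox (Nf ℓ k M) x') :
    lineK ℓ k M a m2 t x x' = ((((ℓ + 1) ^ k : ℕ) : ℝ)) ^ (d + 1) * piece ℓ k M t a m2 (site x hx) (site x' hx') := by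
  unfold lineK
  rw [dif_pos ⟨hx, hx'⟩]

/-- the kernel vanishes when a position is outside the box. [cite: Balaban1983Higgs3, (2.6) p.424] -/
theorem lineK_of_not_inBox {ℓ k : ℕ} {M : Fin (d + 1) → ℕ} {a m2 : ℝ} (t : ℕ) {x x' : Fin (d + 1) → ℕ}
    (h : ¬(InBox (Nf ℓ k M) x ∧ InBox (Nf ℓ k M) x')) : lineK ℓ k M a m2 t x x' = 0 := by
  unfold lineK
  rw [dif_neg h]

/-- **The lines ARE the propagator, expanded by (2.6)**: `Σ_{t<k} K(t; x, x′) = η^{−(d+1)}·G_k(□,0; x, x′)` for positions in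
the box (`B3Ineq210ZeroBox.sum_piece`: `Σ_{j<k} G^η_{(j)} = 𝒢_k = G_k(□)`). [cite: Balaban1983Higgs3, (2.6) p.424] -/
theorem sum_lineK {ℓ k : ℕ} (hk : 1 ≤ k) {M : Fin (d + 1) → ℕ} {a m2 : ℝ} {x x' : Fin (d + 1) → ℕ}
    (hx : InBox (Nf ℓ k M) x) (hx' : InBox (Nf ℓ k M) x') :
    ∑ t ∈ Finset.range k, lineK ℓ k M a m2 t x x'
      = ((((ℓ + 1) ^ k : ℕ) : ℝ)) ^ (d + 1) * B4Thm110ZeroBox.Gfine ℓ k M k a m2 (site x hx) (site x' hx') := by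
  simp only [lineK_of_inBox _ hx hx', ← Finset.mul_sum]
  congr 1
  rw [← sum_piece hk, Matrix.sum_apply]

/-- **(2.10) for the line kernels, from the gen-4 box instance** (`B3Ineq210ZeroBox.ineq210_zeroBox`, value clause): there
are `δ₁ > 0`, `C > 0` (on `d`, `L`, the window) with `|K(t; x, x′)| ≤ C (L^tη)^{2−(d+1)} e^{−δ₁(L^tη)^{−1}·η|x−x′|_∞}` for
every `k ≥ 1`, window point, box, `t` and all positions. [cite: Balaban1983Higgs3, (2.10) p.426] -/
theorem exists_lineK_le (d ℓ : ℕ) (hℓ : 1 ≤ ℓ) (amin aplus m2plus : ℝ) (ha : 0 < amin) :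
    ∃ δ₁ C : ℝ, 0 < δ₁ ∧ 0 < C ∧ ∀ (k : ℕ), 1 ≤ k → ∀ (a m2 : ℝ), amin ≤ a → a ≤ aplus → 0 ≤ m2 →
      m2 ≤ m2plus → ∀ (M : Fin (d + 1) → ℕ), (∀ i, 1 ≤ M i) → ∀ (t : ℕ) (x x' : Fin (d + 1) → ℕ),
        |lineK ℓ k M a m2 t x x'|
          ≤ C * bscale ℓ k t ^ (2 - ((d + 1 : ℕ) : ℝ))
              * Real.exp (-(δ₁ * (bscale ℓ k t)⁻¹ * ((supDist x x' : ℝ) / (((ℓ + 1) ^ k : ℕ) : ℝ)))) := by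
  obtain ⟨δ₁, C, hδ, hC, h⟩ := ineq210_zeroBox d ℓ hℓ amin aplus m2plus ha
  refine ⟨δ₁, C, hδ, hC, fun k hk a m2 h1 h2 h3 h4 M hM t x x' => ?_⟩
  by_cases hin : InBox (Nf ℓ k M) x ∧ InBox (Nf ℓ k M) x'
  · have h0 := (h k hk a m2 h1 h2 h3 h4 M hM t (site x hin.1) (site x' hin.2)).1
    have hdist : supNorm ((site (N := Nf ℓ k M) x hin.1).1 - (site (N := Nf ℓ k M) x' hin.2).1)
        = (supDist x x' : ℝ) := supNorm_toZ_sub x x'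
    rw [lineK_of_inBox t hin.1 hin.2, abs_mul, abs_of_nonneg (by positivity)]
    have h0' : ((((ℓ + 1) ^ k : ℕ) : ℝ)) ^ (d + 1) * |piece ℓ k M t a m2 (site x hin.1) (site x' hin.2)|
        ≤ C * bscale ℓ k t ^ (2 - ((d + 1 : ℕ) : ℝ))
            * Real.exp (-(δ₁ * (bscale ℓ k t)⁻¹ * (supNorm ((site (N := Nf ℓ k M) x hin.1).1
                - (site (N := Nf ℓ k M) x' hin.2).1) / (((ℓ + 1) ^ k : ℕ) : ℝ)))) := h0
    rw [hdist] at h0'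
    exact h0'
  · rw [lineK_of_not_inBox t hin, abs_zero]
    exact mul_nonneg (mul_nonneg hC.le (Real.rpow_pos_of_pos (bscale_pos ℓ k t) _).le) (Real.exp_pos _).le

/-- the decay rate `δ₁(d, L, window)` of `exists_lineK_le`. [cite: Balaban1983Higgs3, (2.10) p.426] -/
def delta1 (d ℓ : ℕ) (hℓ : 1 ≤ ℓ) (amin aplus m2plus : ℝ) (ha : 0 < amin) : ℝ :=
  (exists_lineK_le d ℓ hℓ amin aplus m2plus ha).choose

/-- the constant `C(d, L, window)` of `exists_lineK_le` (the O(1) of (2.10)). [cite: Balaban1983Higgs3, (2.10) p.426] -/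
def const (d ℓ : ℕ) (hℓ : 1 ≤ ℓ) (amin aplus m2plus : ℝ) (ha : 0 < amin) : ℝ :=
  (exists_lineK_le d ℓ hℓ amin aplus m2plus ha).choose_spec.choose

/-- `δ₁ > 0`. [cite: Balaban1983Higgs3, (2.10) p.426] -/
theorem delta1_pos (d ℓ : ℕ) (hℓ : 1 ≤ ℓ) (amin aplus m2plus : ℝ) (ha : 0 < amin) :
    0 < delta1 d ℓ hℓ amin aplus m2plus ha :=
  (exists_lineK_le d ℓ hℓ amin aplus m2plus ha).choose_spec.choose_spec.1

/-- `C > 0`. [cite: Balaban1983Higgs3, (2.10) p.426] -/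
theorem const_pos (d ℓ : ℕ) (hℓ : 1 ≤ ℓ) (amin aplus m2plus : ℝ) (ha : 0 < amin) :
    0 < const d ℓ hℓ amin aplus m2plus ha :=
  (exists_lineK_le d ℓ hℓ amin aplus m2plus ha).choose_spec.choose_spec.2.1

/-- **(2.10) for the line kernels with the chosen constants.** [cite: Balaban1983Higgs3, (2.10) p.426] -/
theorem lineK_le (d ℓ : ℕ) (hℓ : 1 ≤ ℓ) (amin aplus m2plus : ℝ) (ha : 0 < amin) {k : ℕ} (hk : 1 ≤ k) {a m2 : ℝ}
    (h1 : amin ≤ a) (h2 : a ≤ aplus) (h3 : 0 ≤ m2) (h4 : m2 ≤ m2plus) {M : Fin (d + 1) → ℕ} (hM : ∀ i, 1 ≤ M i)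
    (t : ℕ) (x x' : Fin (d + 1) → ℕ) :
    |lineK ℓ k M a m2 t x x'|
      ≤ const d ℓ hℓ amin aplus m2plus ha * bscale ℓ k t ^ (2 - ((d + 1 : ℕ) : ℝ))
          * Real.exp (-(delta1 d ℓ hℓ amin aplus m2plus ha * (bscale ℓ k t)⁻¹
              * ((supDist x x' : ℝ) / (((ℓ + 1) ^ k : ℕ) : ℝ)))) :=
  (exists_lineK_le d ℓ hℓ amin aplus m2plus ha).choose_spec.choose_spec.2.2 k hk a m2 h1 h2 h3 h4 M hM t x x'

/-! ## §3 The graph side: counts of the zero-field box line class, the vertex data -/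

/-- **The combinatorial data of a graph of the class**: lines `l(1), …, l(m)` with endpoints, every vertex on a line,
connected (Proposition 2.1: *"Let G be a connected graph"*), and the *"proper power of L^{j(v)}η"* of each vertex.
[cite: Balaban1983Higgs3, Prop. 2.1 p.424, (2.14) p.427] -/
structure LineGraph (V : Type) [Fintype V] [DecidableEq V] (m : ℕ) where
  /-- first endpoint of `l(i+1)` -/
  src : Fin m → V
  /-- second endpoint of `l(i+1)` -/
  tgt : Fin m → V
  /-- every vertex lies on a line -/
  touches : ∀ v : V, ∃ l : Fin m, src l = v ∨ tgt l = v
  /-- the graph is connected -/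
  conn : LinesConnect src tgt
  /-- the proper power of `L^{j(v)}η` of the vertex `v` -/
  etaPow : V → ℕ

variable {V : Type} [Fintype V] [DecidableEq V] {m : ℕ}

/-- **The counts (gen-2/p19 `B3Ineq215.Counts`) of a graph of the zero-field box line class**: no differentiation acts on a
line, no leg is an averaged vector leg; dimension `d + 1`, block size `L = ℓ + 1`, decay rate `δ₁` = the rate of (2.10) for
the box line kernels (`delta1`). [cite: Balaban1983Higgs3, (2.14) p.427] -/
def boxCounts (Γ : LineGraph V m) (d ℓ : ℕ) (hℓ : 1 ≤ ℓ) (amin aplus m2plus : ℝ) (ha : 0 < amin) : Counts V m where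
  src := Γ.src
  tgt := Γ.tgt
  touches := Γ.touches
  diffOn := fun _ _ => 0
  vecLegAvg := fun _ _ => 0
  etaPow := Γ.etaPow
  d := d + 1
  L := ℓ + 1
  δ₁ := delta1 d ℓ hℓ amin aplus m2plus ha
  d_pos := Nat.succ_pos d
  two_le_L := by omega
  δ₁_pos := delta1_pos d ℓ hℓ amin aplus m2plus ha

section CountsFacts

variable (Γ : LineGraph V m) (dd ℓ : ℕ) (hℓ : 1 ≤ ℓ) (amin aplus m2plus : ℝ) (ha : 0 < amin)

/-- a line has two legs: `Σ_v legsOn v l = 2`. [cite: Balaban1983Higgs3, (2.14) p.427] -/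
theorem sum_legsOn (l : Fin m) :
    ∑ v, ((boxCounts Γ dd ℓ hℓ amin aplus m2plus ha).legsOn v l : ℝ) = 2 := by
  have h : ∀ v, ((boxCounts Γ dd ℓ hℓ amin aplus m2plus ha).legsOn v l : ℝ)
      = (if Γ.src l = v then (1 : ℝ) else 0) + (if Γ.tgt l = v then (1 : ℝ) else 0) := by
    intro v
    unfold Counts.legsOn
    simp only [boxCounts]
    push_cast
    rfl
  simp_rw [h]
  rw [Finset.sum_add_distrib, Finset.sum_ite_eq, Finset.sum_ite_eq]
  simp only [Finset.mem_univ, if_true]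
  norm_num

/-- **the line dimension of an undifferentiated scalar line**: `a_l = −(d−2)/2 · 2 = 2 − d` (here `d ↦ d + 1`).
[cite: Balaban1983Higgs3, (2.1) p.422, (2.14) p.427] -/
theorem boxCounts_lineDim (l : Fin m) :
    (boxCounts Γ dd ℓ hℓ amin aplus m2plus ha).lineDim l = 2 - ((dd + 1 : ℕ) : ℝ) := by
  have h2 := sum_legsOn Γ dd ℓ hℓ amin aplus m2plus ha l
  unfold Counts.lineDim Counts.legExp
  simp only [boxCounts, Nat.cast_zero, sub_zero, add_zero] at h2 ⊢
  rw [← Finset.mul_sum, h2]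
  push_cast
  ring

/-- the model's line dimension. [cite: Balaban1983Higgs3, (2.14) p.427] -/
theorem toModel_a (l : Fin m) :
    (boxCounts Γ dd ℓ hℓ amin aplus m2plus ha).toModel.a l = 2 - ((dd + 1 : ℕ) : ℝ) :=
  boxCounts_lineDim Γ dd ℓ hℓ amin aplus m2plus ha l

/-- the model's scale `L^tη` is `bscale`. [cite: Balaban1983Higgs3, (2.10) p.426] -/
theorem toModel_sc (k t : ℕ) :
    (boxCounts Γ dd ℓ hℓ amin aplus m2plus ha).toModel.sc k t = bscale ℓ k t := by
  unfold Model.sc bscale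
  simp only [Counts.toModel, boxCounts]
  push_cast
  ring

/-- the model's rate: `2δ₀ = δ₁`. [cite: Balaban1983Higgs3, (2.14) p.427] -/
theorem toModel_two_mul_δ₀ :
    2 * (boxCounts Γ dd ℓ hℓ amin aplus m2plus ha).toModel.δ₀ = delta1 dd ℓ hℓ amin aplus m2plus ha := by
  simp only [Counts.toModel, boxCounts]
  ring

/-- the model's `(L^k)⁻¹ = η`. [cite: Balaban1983Higgs3, (2.10) p.426] -/
theorem toModel_Lpow (k : ℕ) :
    (((boxCounts Γ dd ℓ hℓ amin aplus m2plus ha).toModel.L : ℝ) ^ k) = (((ℓ + 1) ^ k : ℕ) : ℝ) := by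
  simp only [Counts.toModel, boxCounts]
  push_cast
  ring

end CountsFacts

/-- **The vertex side of the amplitude (p19's hypothesis (i), kept as data)**: the vertex functions `u_v` on positions, the
running couplings `e(L^kε), λ(L^kε) ≥ 0`, the orders `d_v(v), d_s(v)`, the norms `N^Φ_v, N^A_v ≥ 0` of the external fields
localized at `v`, and the vertex bound *"The external fields are estimated further by the Hölder norms … |q| ≦ 1,
|R_{n̄+1}(·)| ≦ 1"* with the proper power `η^{e_v}`, `η = L^{−k}`. [cite: Balaban1983Higgs3, (2.13) p.426] -/
structure VertexData (V : Type) [Fintype V] (d ℓ k : ℕ) (etaPow : V → ℕ) where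
  /-- the vertex functions `u_v(x)` -/
  u : V → (Fin (d + 1) → ℕ) → ℝ
  /-- `e(L^kε)` -/
  eRun : ℝ
  /-- `λ(L^kε)` -/
  lamRun : ℝ
  /-- `d_v(v)` -/
  dv : V → ℕ
  /-- `d_s(v)` -/
  ds : V → ℕ
  /-- `N^Φ_v` -/
  NPhi : V → ℝ
  /-- `N^A_v` -/
  NA : V → ℝ
  eRun_nonneg : 0 ≤ eRun
  lamRun_nonneg : 0 ≤ lamRun
  NPhi_nonneg : ∀ v, 0 ≤ NPhi v
  NA_nonneg : ∀ v, 0 ≤ NA v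
  /-- the vertex bound -/
  u_le : ∀ v x, |u v x| ≤ eRun ^ dv v * lamRun ^ ds v * NPhi v * NA v
    * (((((ℓ + 1 : ℕ) : ℝ)) ^ k)⁻¹) ^ (etaPow v : ℝ)

/-! ## §4 The amplitude of the zero-field box line class and its estimates (2.13), (1.33) -/

/-- **The localized lattice amplitude of a graph of the zero-field box line class** (p19's `Amp` over the model of
`boxCounts`): scale `k ≥ 1` (`η = L^{−k}`), unit cubes `□(v)`, the supplied vertex data, and the LINE KERNELS = the (2.6)
pieces of `G_k(□,0)` on the box `□ = Π_μ[0,M_μ)` at the window point `(a, m²)` (`lineK`), constants `C_l = C` of `lineK_le`;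
the line hypothesis `K_le` ((2.10)) is DISCHARGED by `lineK_le`. [cite: Balaban1983Higgs3, (2.13) p.426, (2.10) p.426] -/
def boxAmp (Γ : LineGraph V m) (d ℓ : ℕ) (hℓ : 1 ≤ ℓ) (amin aplus m2plus : ℝ) (ha : 0 < amin) {k : ℕ} (hk : 1 ≤ k)
    {a m2 : ℝ} (h1 : amin ≤ a) (h2 : a ≤ aplus) (h3 : 0 ≤ m2) (h4 : m2 ≤ m2plus) (M : Fin (d + 1) → ℕ)
    (hM : ∀ i, 1 ≤ M i) (box : V → Fin (d + 1) → ℕ) (P : VertexData V d ℓ k Γ.etaPow) :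
    Amp (boxCounts Γ d ℓ hℓ amin aplus m2plus ha).toModel where
  k := k
  box := box
  u := P.u
  K := fun _ t x x' => lineK ℓ k M a m2 t x x'
  C := fun _ => const d ℓ hℓ amin aplus m2plus ha
  eRun := P.eRun
  lamRun := P.lamRun
  dv := P.dv
  ds := P.ds
  NPhi := P.NPhi
  NA := P.NA
  C_nonneg := fun _ => (const_pos d ℓ hℓ amin aplus m2plus ha).le
  eRun_nonneg := P.eRun_nonneg
  lamRun_nonneg := P.lamRun_nonneg
  NPhi_nonneg := P.NPhi_nonneg
  NA_nonneg := P.NA_nonneg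
  e_nonneg := fun v => Nat.cast_nonneg _
  conn := Γ.conn
  u_le := fun v x => P.u_le v x
  K_le := fun l t _ x x' => by
    have h := lineK_le d ℓ hℓ amin aplus m2plus ha hk h1 h2 h3 h4 hM t x x'
    have hδ : (boxCounts Γ d ℓ hℓ amin aplus m2plus ha).toModel.δ₀ = delta1 d ℓ hℓ amin aplus m2plus ha / 2 := rfl
    have hexp : Real.exp (-(2 * (delta1 d ℓ hℓ amin aplus m2plus ha / 2) / bscale ℓ k t
        * ((((boxCounts Γ d ℓ hℓ amin aplus m2plus ha).toModel.L : ℝ) ^ k)⁻¹ * (supDist x x' : ℝ))))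
        = Real.exp (-(delta1 d ℓ hℓ amin aplus m2plus ha * (bscale ℓ k t)⁻¹
            * ((supDist x x' : ℝ) / (((ℓ + 1) ^ k : ℕ) : ℝ)))) := by
      congr 1
      rw [toModel_Lpow]
      ring
    rw [toModel_a, toModel_sc, hδ, hexp]
    exact h

section AmpFacts

variable (Γ : LineGraph V m) (dd ℓ : ℕ) (hℓ : 1 ≤ ℓ) (amin aplus m2plus : ℝ) (ha : 0 < amin) {k : ℕ} (hk : 1 ≤ k)
  {a m2 : ℝ} (h1 : amin ≤ a) (h2 : a ≤ aplus) (h3 : 0 ≤ m2) (h4 : m2 ≤ m2plus) (M : Fin (dd + 1) → ℕ)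
  (hM : ∀ i, 1 ≤ M i) (box : V → Fin (dd + 1) → ℕ) (P : VertexData V dd ℓ k Γ.etaPow)

/-- the lines of `boxAmp` are the box line kernels. [cite: Balaban1983Higgs3, (2.6) p.424] -/
theorem boxAmp_K (l : Fin m) (t : ℕ) (x x' : Fin (dd + 1) → ℕ) :
    (boxAmp Γ dd ℓ hℓ amin aplus m2plus ha hk h1 h2 h3 h4 M hM box P).K l t x x' = lineK ℓ k M a m2 t x x' := rfl

/-- the scale of `boxAmp`. [cite: Balaban1983Higgs3, (2.13) p.426] -/
theorem boxAmp_k : (boxAmp Γ dd ℓ hℓ amin aplus m2plus ha hk h1 h2 h3 h4 M hM box P).k = k := rfl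

/-- **(2.13) for the zero-field box line class, NO line hypothesis**: p19's `Amp.ineq213` for `boxAmp` at every scale
assignment `j ∈ J(l̃)`. [cite: Balaban1983Higgs3, (2.13) p.426] -/
theorem ineq213_boxAmp {j : Fin m → ℕ} (hj : j ∈ Model.Mon m k) :
    B3Sect2FirstEstimate.Ineq213
      ((boxCounts Γ dd ℓ hℓ amin aplus m2plus ha).toScaledGraph k j box)
      (∏ _l : Fin m, const dd ℓ hℓ amin aplus m2plus ha) {j}
      (boxAmp Γ dd ℓ hℓ amin aplus m2plus ha hk h1 h2 h3 h4 M hM box P).E P.eRun P.lamRun (∑ v, P.dv v)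
      (∑ v, P.ds v) (boxTreeLen (ℓ + 1) k box) (∏ v, P.NPhi v) (∏ v, P.NA v) :=
  (boxAmp Γ dd ℓ hℓ amin aplus m2plus ha hk h1 h2 h3 h4 M hM box P).ineq213 hj

/-- **(2.13) summed over `J(l̃)` for the zero-field box line class.** [cite: Balaban1983Higgs3, (2.13) p.426] -/
theorem ineq213_sum_boxAmp :
    |∑ j ∈ Model.Mon m k, (boxAmp Γ dd ℓ hℓ amin aplus m2plus ha hk h1 h2 h3 h4 M hM box P).E j|
      ≤ (∏ _l : Fin m, const dd ℓ hℓ amin aplus m2plus ha)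
        * (P.eRun ^ (∑ v, P.dv v) * P.lamRun ^ (∑ v, P.ds v)
            * Real.exp (-(delta1 dd ℓ hℓ amin aplus m2plus ha / 2 * boxTreeLen (ℓ + 1) k box))
            * (∏ v, P.NPhi v) * ∏ v, P.NA v)
        * ∑ j ∈ Model.Mon m k, ((boxCounts Γ dd ℓ hℓ amin aplus m2plus ha).toScaledGraph k j box).Etilde j :=
  (boxAmp Γ dd ℓ hℓ amin aplus m2plus ha hk h1 h2 h3 h4 M hM box P).ineq213_sum

/-- **(1.33) at a fixed ordering for the zero-field box line class, NO line hypothesis** (p19's `Amp.bound133`, given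
Proposition 2.2's positivity of the degrees of the non-trivial subgraphs). [cite: Balaban1983Higgs3, (1.33) p.420, (2.13) p.426,
Prop. 2.2 p.428] -/
theorem bound133_boxAmp
    (hpos : ∀ i, i ≤ m → ∀ b ∈ (boxCounts Γ dd ℓ hℓ amin aplus m2plus ha).toModel.reps i,
      (boxCounts Γ dd ℓ hℓ amin aplus m2plus ha).toModel.Nontriv i b →
        0 < (boxCounts Γ dd ℓ hℓ amin aplus m2plus ha).toModel.D i b) :
    |∑ j ∈ Model.Mon m k, (boxAmp Γ dd ℓ hℓ amin aplus m2plus ha hk h1 h2 h3 h4 M hM box P).E j|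
      ≤ (∏ _l : Fin m, const dd ℓ hℓ amin aplus m2plus ha)
        * (boxCounts Γ dd ℓ hℓ amin aplus m2plus ha).toModel.const215
        * (P.eRun ^ (∑ v, P.dv v) * P.lamRun ^ (∑ v, P.ds v)
            * Real.exp (-(delta1 dd ℓ hℓ amin aplus m2plus ha / 2 * boxTreeLen (ℓ + 1) k box))
            * (∏ v, P.NPhi v) * ∏ v, P.NA v) :=
  (boxAmp Γ dd ℓ hℓ amin aplus m2plus ha hk h1 h2 h3 h4 M hM box P).bound133 hpos

end AmpFacts

/-! ## §5 Non-vacuity witness -/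

/-- the one-line graph on two vertices. [cite: Balaban1983Higgs3, Prop. 2.1 p.424] -/
def twoVertexGraph : LineGraph (Fin 2) 1 where
  src := fun _ => 0
  tgt := fun _ => 1
  touches := fun v => ⟨0, by fin_cases v <;> simp⟩
  conn := by
    intro u w
    have h01 : Relation.EqvGen (fun a b : Fin 2 => ∃ l : Fin 1, (fun _ => (0 : Fin 2)) l = a ∧
        (fun _ => (1 : Fin 2)) l = b) 0 1 := Relation.EqvGen.rel _ _ ⟨0, rfl, rfl⟩
    fin_cases u <;> fin_cases w
    · exact Relation.EqvGen.refl _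
    · exact h01
    · exact Relation.EqvGen.symm _ _ h01
    · exact Relation.EqvGen.refl _
  etaPow := fun _ => 0

/-- trivial vertex data (all vertex functions zero). [cite: Balaban1983Higgs3, (2.13) p.426] -/
def zeroVertexData (V : Type) [Fintype V] (d ℓ k : ℕ) (etaPow : V → ℕ) : VertexData V d ℓ k etaPow where
  u := fun _ _ => 0
  eRun := 0
  lamRun := 0
  dv := fun _ => 0
  ds := fun _ => 0
  NPhi := fun _ => 1
  NA := fun _ => 1
  eRun_nonneg := le_rfl
  lamRun_nonneg := le_rfl
  NPhi_nonneg := fun _ => zero_le_one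
  NA_nonneg := fun _ => zero_le_one
  u_le := fun v x => by
    rw [abs_zero]
    positivity

/-- **Witness (non-vacuity of the class)**: the amplitude of the one-line graph in `d + 1 = 3`, `L = 2`, `k = 1`,
`□ = [0,1)³`, `a = 1`, `m² = 0` (window `[1/2, 2] × [0, 1]`), with zero vertex functions, is a member of p19's class whose
line kernels are the pieces of the box propagator `G_1(□,0)`. [cite: Balaban1983Higgs3, (2.13) p.426] -/
theorem boxAmp_witness :
    ∃ A : Amp (boxCounts twoVertexGraph 2 1 le_rfl (1 / 2) 2 1 (by norm_num)).toModel,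
      A.k = 1 ∧ ∀ (l : Fin 1) (t : ℕ) (x x' : Fin 3 → ℕ), A.K l t x x' = lineK 1 1 (fun _ => 1) 1 0 t x x' :=
  ⟨boxAmp twoVertexGraph 2 1 le_rfl (1 / 2) 2 1 (by norm_num) (k := 1) le_rfl (a := 1) (m2 := 0)
    (by norm_num) (by norm_num) le_rfl (by norm_num) (fun _ => 1) (fun _ => le_rfl) (fun _ _ => 0)
    (zeroVertexData (Fin 2) 2 1 1 _), rfl, fun _ _ _ _ => rfl⟩

end

end Literature.MathematicalPhysics.QuantumFieldTheory.Balaban1983to89.B3Ineq213ZeroBoxLines
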